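import Summits.QuantumAdvantage.AdviceFreeQNC0.TwoClassAvoidance
import Summits.QuantumAdvantage.AdviceFreeQNC0.LayerGrowth
import HarnessLib

/-!
# Cell qa-qnc0 (rung F-Q1, route RingFrame, crux α, line `product`): shifted products of a
# low-degree `𝔽₂`-polynomial with its translates, and the one-shift two-class bound

Planner statements HOME/qa-qnc0-p1/Sketch6.lean (TARGET.md §19.1, "PROVED in prose"), now kernel
theorems.  Let `g : {0,1}ⁿ → 𝔽₂` have degree `≤ d`, `B = {u : g u ≠ 0}`, a residue `r` and a shift
`S` of size `ℓ ≢ 0 (mod 3)` with `D := 2d + ℓ`, `2D + 2 ≤ n`, `T := Σ_{j < ⌈n/2⌉ − D} C(n, j)`.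

* `shiftedProductLowDeg` (`ShiftedProductLowDeg`, literally): the shifted product
  `P_S := g · Π_{i∈S}(1 − u_i) · (g ∘ τ_S)` has degree `≤ 2d + |S|` and support = the rooted
  up-pairs `{u ∈ B : S ⊆ zeros u, u + 1_S ∈ B}` (tree lemmas `mul_mem_lowDeg_add`,
  `Hegedus.cpl_mem_lowDeg`, `Smolensky.comp_subst_mem_lowDeg`; no new definitions).
* `homeClassPinning` (`HomeClassPinning`, literally): if neither endpoint of a pair lies in the
  class `r` then the root lies in the single home class `r + ℓ` (arithmetic mod 3, `ℓ ≢ 0`).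
* `shift_bound`: `T · |supp P_S| ≤ 2^{n+1} · #{u ∈ supp P_S : u ∈ L_r ∨ u + 1_S ∈ L_r}` — the
  landed two-class theorem `twoClassAvoidanceExplicit` (Beck–Li immunity + Keevash–Sudakov
  Hilbert bound) applied to `P_S` with the home class, plus pinning.
* counting helpers (fibres of sets of pairs, `ℓ`-subsets of the zero / one set of a point) used
  by the summed bound `pairRichnessBound` (file `PairRichness.lean`).

These are the cell's statements (qa-qnc0 TARGET.md §19), not in print; the library input is the
landed `twoClassAvoidanceExplicit`.  WHAT THIS IS NOT: nothing on `LDMAPolylog` or on α; no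
separation.

## References

* C. Beck, Y. Li, *Represent MOD function by low degree polynomial with unbounded one-sided
  error*, arXiv:1304.0713 (2013), Thm. 3.4 [BeckLi2013].
* S. Jukna, *Boolean Function Complexity*, Springer (2012), §2.1 [JuknaBFC2012].
-/

noncomputable section

namespace Summit.QuantumAdvantage.AdviceFreeQNC0

open Finset
open Literature.Computability.MetaComplexity Literature.Computability.MetaComplexity.Smolensky
open Literature.Computability.MetaComplexity.Hegedus

variable {n : ℕ}

/-! ### The shifted product -/

/-- Pointwise formula for the complement-reflected monomial `Π_{i ∈ S} (1 − u_i)`: the indicator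
of `S ⊆ zeros u`. [folklore] -/
theorem cpl_mono_apply (S : Finset (Fin n)) (u : Fin n → Bool) :
    cpl (mono (ZMod 2) S) u = if ∀ i ∈ S, u i = false then 1 else 0 := by
  unfold cpl
  rw [mono_apply]
  have h : (∀ i ∈ S, (!u i) = true) ↔ ∀ i ∈ S, u i = false := by
    simp only [Bool.not_eq_true']
  by_cases hS : ∀ i ∈ S, u i = false
  · rw [if_pos (h.2 hS), if_pos hS]
  · rw [if_neg (fun h' => hS (h.1 h')), if_neg hS]

/-- Substituting the constant `1` for the variables in `S` preserves the degree filtration.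
[cite: JuknaBFC2012, §2.1] -/
theorem comp_setTrue_mem_lowDeg {d : ℕ} {g : CubeFn (ZMod 2) n} (hg : g ∈ lowDeg (ZMod 2) n d)
    (S : Finset (Fin n)) :
    (fun u : Fin n → Bool => g (fun i => if i ∈ S then true else u i)) ∈ lowDeg (ZMod 2) n d := by
  classical
  refine comp_subst_mem_lowDeg (fun (u : Fin n → Bool) (i : Fin n) => if i ∈ S then true else u i)
    (fun i => ?_) hg
  by_cases h : i ∈ S
  · exact Or.inl ⟨true, fun x => by simp [h]⟩
  · exact Or.inr ⟨i, fun x => by simp [h]⟩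

/-- **`ShiftedProductLowDeg` (planner Sketch6 §19.1 (1)), literally:** the shifted product
`P_S = g · Π_{i∈S}(1 − u_i) · (g ∘ τ_S)` has degree `≤ 2d + |S|` and support
`{u : S ⊆ zeros u, g u ≠ 0, g (u + 1_S) ≠ 0}`. (Cell statement, TARGET.md §19.1.)
[cite: JuknaBFC2012, §2.1] -/
theorem shiftedProductLowDeg :
    ∀ n d : ℕ, ∀ S : Finset (Fin n), ∀ g : CubeFn (ZMod 2) n, g ∈ lowDeg (ZMod 2) n d →
      ∃ P : CubeFn (ZMod 2) n, P ∈ lowDeg (ZMod 2) n (2 * d + S.card) ∧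
        ∀ u : Fin n → Bool, (P u ≠ 0 ↔
          ((∀ i ∈ S, u i = false) ∧ g u ≠ 0 ∧ g (fun i => if i ∈ S then true else u i) ≠ 0)) := by
  intro n d S g hg
  refine ⟨g * cpl (mono (ZMod 2) S) * fun u => g (fun i => if i ∈ S then true else u i), ?_, ?_⟩
  · have hcpl : cpl (mono (ZMod 2) S) ∈ lowDeg (ZMod 2) n S.card :=
      cpl_mem_lowDeg (mono_mem_lowDeg le_rfl)
    have h := mul_mem_lowDeg_add (mul_mem_lowDeg_add hg hcpl) (comp_setTrue_mem_lowDeg hg S)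
    have hD : d + S.card + d = 2 * d + S.card := by ring
    rw [hD] at h
    exact h
  · intro u
    rw [Pi.mul_apply, Pi.mul_apply, mul_ne_zero_iff, mul_ne_zero_iff, cpl_mono_apply]
    constructor
    · rintro ⟨⟨hg, hz⟩, hs⟩
      refine ⟨?_, hg, hs⟩
      by_contra h
      exact hz (if_neg h)
    · rintro ⟨hz, hg, hs⟩
      exact ⟨⟨hg, by rw [if_pos hz]; exact one_ne_zero⟩, hs⟩

/-! ### Pinning of the home class -/

/-- **`HomeClassPinning` (planner Sketch6 §19.1 (2)), literally:** `ℓ ≢ 0`, `w ≢ r`, `w + ℓ ≢ r`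
`(mod 3)` force `w ≡ r + ℓ`. -/
theorem homeClassPinning :
    ∀ ℓ r w : ℕ, ℓ % 3 ≠ 0 → w % 3 ≠ r % 3 → (w + ℓ) % 3 ≠ r % 3 → w % 3 = (r + ℓ) % 3 := by
  intro ℓ r w hℓ hw hwl
  have h1 : ℓ % 3 = 1 ∨ ℓ % 3 = 2 := by omega
  have h2 : w % 3 = 0 ∨ w % 3 = 1 ∨ w % 3 = 2 := by omega
  rcases h1 with h1 | h1 <;> rcases h2 with h2 | h2 | h2 <;> omega

/-! ### Counting over pairs -/

/-- Count a set of pairs fibrewise over the second coordinate. [folklore] -/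
theorem card_eq_sum_card_fibre_snd {α β : Type*} [Fintype β] [DecidableEq β] (s : Finset (α × β)) :
    s.card = ∑ b, (s.filter fun p => p.2 = b).card :=
  Finset.card_eq_sum_card_fiberwise fun _ _ => Finset.mem_coe.2 (Finset.mem_univ _)

/-- Count a set of pairs fibrewise over the first coordinate. [folklore] -/
theorem card_eq_sum_card_fibre_fst {α β : Type*} [Fintype α] [DecidableEq α] (s : Finset (α × β)) :
    s.card = ∑ a, (s.filter fun p => p.1 = a).card :=
  Finset.card_eq_sum_card_fiberwise fun _ _ => Finset.mem_coe.2 (Finset.mem_univ _)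

/-- Identify a fibre over the second coordinate with a set of first coordinates. [folklore] -/
theorem card_fibre_snd_eq {α β : Type*} [DecidableEq β] (s : Finset (α × β)) (b : β)
    (t : Finset α) (h : ∀ a, (a, b) ∈ s ↔ a ∈ t) :
    (s.filter fun p => p.2 = b).card = t.card :=
  Finset.card_bij (fun p _ => p.1)
    (fun p hp => by
      rw [Finset.mem_filter] at hp
      have e : (p.1, b) = p := by rw [← hp.2]
      exact (h p.1).1 (e ▸ hp.1))
    (fun p hp p' hp' he => by
      rw [Finset.mem_filter] at hp hp'
      exact Prod.ext he (hp.2.trans hp'.2.symm))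
    (fun a ha => ⟨(a, b), Finset.mem_filter.2 ⟨(h a).2 ha, rfl⟩, rfl⟩)

/-- Identify a fibre over the first coordinate with a set of second coordinates. [folklore] -/
theorem card_fibre_fst_eq {α β : Type*} [DecidableEq α] (s : Finset (α × β)) (a : α)
    (t : Finset β) (h : ∀ b, (a, b) ∈ s ↔ b ∈ t) :
    (s.filter fun p => p.1 = a).card = t.card :=
  Finset.card_bij (fun p _ => p.2)
    (fun p hp => by
      rw [Finset.mem_filter] at hp
      have e : (a, p.2) = p := by rw [← hp.2]
      exact (h p.2).1 (e ▸ hp.1))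
    (fun p hp p' hp' he => by
      rw [Finset.mem_filter] at hp hp'
      exact Prod.ext (hp.2.trans hp'.2.symm) he)
    (fun b hb => ⟨(a, b), Finset.mem_filter.2 ⟨(h b).2 hb, rfl⟩, rfl⟩)

/-- The number of `ℓ`-subsets of the zero set of `x` is `C(n − |x|, ℓ)`. [folklore] -/
theorem card_subsets_zeros (x : Fin n → Bool) (ℓ : ℕ) :
    (univ.filter fun S : Finset (Fin n) => S.card = ℓ ∧ ∀ i ∈ S, x i = false).card =
      (n - wt x).choose ℓ := by
  classical
  have hz : (univ.filter fun i : Fin n => x i = false).card = n - wt x := by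
    have := wt_add_card_false n x
    omega
  rw [← hz, ← Finset.card_powersetCard]
  congr 1
  ext S
  simp only [Finset.mem_filter, Finset.mem_univ, true_and, Finset.mem_powersetCard,
    Finset.subset_iff]
  tauto

/-- The number of `ℓ`-subsets of the one set of `x` is `C(|x|, ℓ)`. [folklore] -/
theorem card_subsets_ones (x : Fin n → Bool) (ℓ : ℕ) :
    (univ.filter fun S : Finset (Fin n) => S.card = ℓ ∧ ∀ i ∈ S, x i = true).card =
      (wt x).choose ℓ := by
  classical
  unfold wt
  rw [← Finset.card_powersetCard]
  congr 1
  ext S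
  simp only [Finset.mem_filter, Finset.mem_univ, true_and, Finset.mem_powersetCard,
    Finset.subset_iff]
  tauto

/-! ### The pair-richness bound -/

/-- **One shift `S`:** `T · |supp P_S| ≤ 2^{n+1} · #{u ∈ supp P_S : u ∈ L_r ∨ u + 1_S ∈ L_r}`, where
`supp P_S = {u : S ⊆ zeros u, g u ≠ 0, g (u + 1_S) ≠ 0}` — the two-class theorem on the shifted
product with the home class `r + ℓ`, then pinning. (Cell statement, TARGET.md §19.1 (3).)
[cite: BeckLi2013, Theorem 3.4] -/
theorem shift_bound {d ℓ r : ℕ} (hℓ : ℓ % 3 ≠ 0) (hn : 2 * (2 * d + ℓ) + 2 ≤ n)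
    {g : CubeFn (ZMod 2) n} (hg : g ∈ lowDeg (ZMod 2) n d) {S : Finset (Fin n)} (hS : S.card = ℓ) :
    (∑ j ∈ range ((n + 1) / 2 - (2 * d + ℓ)), n.choose j) *
        (univ.filter fun u : Fin n → Bool =>
          (∀ i ∈ S, u i = false) ∧ g u ≠ 0 ∧ g (fun i => if i ∈ S then true else u i) ≠ 0).card ≤
      2 ^ (n + 1) *
        (univ.filter fun u : Fin n → Bool =>
          ((∀ i ∈ S, u i = false) ∧ g u ≠ 0 ∧ g (fun i => if i ∈ S then true else u i) ≠ 0) ∧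
          (wt u % 3 = r % 3 ∨ (wt u + ℓ) % 3 = r % 3)).card := by
  classical
  obtain ⟨P, hPdeg, hPiff⟩ := shiftedProductLowDeg n d S g hg
  rw [hS] at hPdeg
  set T := ∑ j ∈ range ((n + 1) / 2 - (2 * d + ℓ)), n.choose j with hT
  set Bs := univ.filter fun u : Fin n → Bool => P u ≠ 0 with hBs
  set As := univ.filter fun u : Fin n → Bool => P u ≠ 0 ∧ wt u % 3 = (r + ℓ) % 3 with hAs
  set Es := univ.filter fun u : Fin n → Bool => P u ≠ 0 ∧ ¬ wt u % 3 = (r + ℓ) % 3 with hEs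
  have hB' : (univ.filter fun u : Fin n → Bool =>
      (∀ i ∈ S, u i = false) ∧ g u ≠ 0 ∧ g (fun i => if i ∈ S then true else u i) ≠ 0) = Bs :=
    Finset.filter_congr fun u _ => (hPiff u).symm
  have hE' : (univ.filter fun u : Fin n → Bool =>
      ((∀ i ∈ S, u i = false) ∧ g u ≠ 0 ∧ g (fun i => if i ∈ S then true else u i) ≠ 0) ∧
        (wt u % 3 = r % 3 ∨ (wt u + ℓ) % 3 = r % 3)) =
      univ.filter fun u : Fin n → Bool => P u ≠ 0 ∧ (wt u % 3 = r % 3 ∨ (wt u + ℓ) % 3 = r % 3) :=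
    Finset.filter_congr fun u _ => by rw [hPiff u]
  rw [hB', hE']
  -- the landed two-class theorem, class `r + ℓ`
  have h2 : 2 ^ (n + 1) * As.card ≤ Bs.card * (2 ^ (n + 1) - T) :=
    twoClassAvoidanceExplicit n (2 * d + ℓ) 3 (r + ℓ) (by decide) le_rfl hn P hPdeg
  have hTle : T ≤ 2 ^ (n + 1) := by
    calc T ≤ ∑ j ∈ range (n + 1), n.choose j :=
          Finset.sum_le_sum_of_subset (Finset.range_mono (by omega))
      _ = 2 ^ n := Nat.sum_range_choose n
      _ ≤ 2 ^ (n + 1) := Nat.pow_le_pow_right (by norm_num) (by omega)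
  have hsplit : As.card + Es.card = Bs.card := by
    rw [hAs, hEs, hBs, ← Finset.filter_filter, ← Finset.filter_filter]
    exact Finset.card_filter_add_card_filter_not _
  -- `T·|Bs| ≤ 2^{n+1}·|Es|`
  have hkey : T * Bs.card ≤ 2 ^ (n + 1) * Es.card := by
    have h3 : Bs.card * (2 ^ (n + 1) - T) + Bs.card * T = Bs.card * 2 ^ (n + 1) := by
      rw [← Nat.mul_add, Nat.sub_add_cancel hTle]
    have h4 : 2 ^ (n + 1) * As.card + Bs.card * T ≤ 2 ^ (n + 1) * (As.card + Es.card) := by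
      rw [hsplit]; calc
        2 ^ (n + 1) * As.card + Bs.card * T ≤ Bs.card * (2 ^ (n + 1) - T) + Bs.card * T :=
            Nat.add_le_add_right h2 _
        _ = 2 ^ (n + 1) * Bs.card := by rw [h3, Nat.mul_comm]
    rw [Nat.mul_add] at h4
    rw [Nat.mul_comm]
    omega
  -- pinning: outside the home class a pair touches `L_r`
  have hEle : Es.card ≤ (univ.filter fun u : Fin n → Bool => P u ≠ 0 ∧
      (wt u % 3 = r % 3 ∨ (wt u + ℓ) % 3 = r % 3)).card := by
    refine Finset.card_le_card fun u hu => ?_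
    rw [hEs, Finset.mem_filter] at hu
    refine Finset.mem_filter.2 ⟨Finset.mem_univ u, hu.2.1, ?_⟩
    by_contra hno
    push Not at hno
    exact hu.2.2 (homeClassPinning ℓ r (wt u) hℓ hno.1 hno.2)
  exact hkey.trans (Nat.mul_le_mul_left _ hEle)

end Summit.QuantumAdvantage.AdviceFreeQNC0
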